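import Mathlib
import Summits.ValiantsHypothesis.ValiantsHypothesis.Theses.TwistedDetRank
import Summits.ValiantsHypothesis.ValiantsHypothesis.Theorems.TwistedDetRankTdrPerNotQPStubConeRestriction
import Summits.ValiantsHypothesis.ValiantsHypothesis.Theorems.TwistedDetRankTdrPerNotQPStubConePowerRankThree
import Summits.ValiantsHypothesis.ValiantsHypothesis.Theorems.TwistedDetRankTdrPerNotQPStubExpBeatsQP

/-!
# Birth skeleton (BC3) for crux `TwistedDetRank.TdrPerNotQP`
# (stmt-ValiantsHypothesis-6284, route-ValiantsHypothesis-TwistedDetRank; skeleton-register, gen 1)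

Crux decl `Summit.ValiantsHypothesis.ValiantsHypothesis.Theses.TwistedDetRank.TdrPerNotQP`
(X1 of the thesis, rank 3):
`¬ ∃ c, ∀ n, ∃ r ≤ 2^((log₂ n + c)^c), ∃ E : Fin r → ℂ^{n×n}, per_n = ∑_t det (X ∘ E_t)` — the
twisted-determinantal rank `tdr(per_n)` is not quasi-polynomially bounded.

## The line: YOUNG-SUBGROUP RESTRICTION + CONE PRODUCT RANK OF A TENSOR POWER

Comparing coefficients of permutation monomials, a representation `per_n = ∑_{t<r} det (X ∘ E_t)`
is the same thing as an identity `sgn σ = ∑_{t<r} Ê_t(σ)` on `𝔖_n`, `Ê(σ) = ∏_i E (σ i) i` a point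
of the BIRKHOFF CONE `Y_n = {Ê : E ∈ ℂ^{n×n}} ⊂ ℂ^{𝔖_n}` (landed:
`Theorems.TwistedDetRankTdrSuperadditive.perPoly_eq_sum_twistedDet_iff`).  Restricting that identity
to the Young subgroup `𝔖_k^m ≤ 𝔖_{mk}` (block permutations `π = (π_1, …, π_m)`,
`sgn π = ∏_b sgn π_b`; the product over `Fin (m*k)` splits along `finProdFinEquiv` into the `m`
diagonal `k × k` blocks `u_{t,b}` of `E_t`) gives a length-`r` decomposition

  `sgn_k ⊗ ⋯ ⊗ sgn_k = ∑_{t<r} û_{t,1} ⊗ ⋯ ⊗ û_{t,m}`,   `û_{t,b} ∈ Y_k`,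

of the `m`-th TENSOR POWER of the single explicit point `sgn_k ∈ ℂ^{k!}` into products of points
of the single fixed toric cone `Y_k` (the affine cone over the Birkhoff toric variety; for `k = 3`
the cubic fourfold `z_{e₁}z_{e₂}z_{e₃} = z_{o₁}z_{o₂}z_{o₃}` in `ℂ⁶`).  Write `R_k(m)` for the least
such `r` (the route's "Birkhoff-cone product rank"; `R_3(1) = 2`, `R_3(2) = 3`,
`m + 1 ≤ R_3(m) ≤ 2^m`; `R_k ≡ 1` for `k ≤ 2` since `sgn_k ∈ Y_k` there).  So
`tdr(per_{mk}) ≥ R_k(m)`, and the crux follows from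

* `stub_coneRestriction` (PROVABLE NOW, size M; the restriction just described, for every block
  size `k`): a length-`r` twisted representation of `per_{m·k}` yields a length-`r` cone product
  decomposition of `sgn_k^{⊗m}`.  Proof route: `perPoly_eq_sum_twistedDet_iff`, then evaluate at
  `σ = finProdFinEquiv.permCongr (Equiv.prodCongrRight π)` (`Equiv.Perm.sign_permCongr`,
  `Equiv.Perm.sign_prodCongrRight`, `Fintype.prod_equiv` + `Fintype.prod_prod_type`), with
  `u t b i j := E t (finProdFinEquiv (b, i)) (finProdFinEquiv (b, j))`.  It is the `m`-fold,
  size-`k` analogue of the landed two-block lemma `TwistedDetRankTdrSuperadditive.sign_mul_sign_eq_of_rep`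
  and the coefficient-space form of the landed support `TdrBlockMonotone` (which works at the level of
  polynomials and needs the scalar-absorption trick; here no `1 ≤ m` guard is needed).
* `stub_conePowerRankNotQP` (OPEN — the load-bearing stub): for SOME fixed block size `k`, the cone
  product rank `m ↦ R_k(m)` of `sgn_k^{⊗m}` is not quasi-polynomially bounded:
  `∃ k, ¬ ∃ c, ∀ m, ∃ r ≤ 2^((log₂ m + c)^c), ∃ (u_{t,b})_{t<r, b<m} ⊂ ℂ^{k×k},
   ∀ π ∈ 𝔖_k^m, ∑_t ∏_b û_{t,b}(π_b) = ∏_b sgn π_b`.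
  This is the TRANSFER of the crux to the tensor-power setting, in its weakest sufficient form: it is
  implied by the route's rank-4 crux `DirectSumExp` (`k = 3`, `R_3(m) ≥ 2^{cm}`; a twisted
  representation of `per_3^{⊕m}` and a cone product decomposition of `sgn_3^{⊗m}` are the same data —
  block-diagonal twists one way, coefficient extraction the other), but it only asks for
  super-quasi-polynomial growth and lets the block size be any constant.  Why plausibly true: it is a
  consequence of `DetQP.DetqpThesis` (a sum of `r` twisted `n × n` determinants has `dc ≤ poly(r,n)`,
  and `per_k^{⊕m}` is a projection of `per_{mk}`), i.e. of the extended Valiant hypothesis, exactly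
  like the crux; and `R_3` is already strictly super-multiplicative-defective (`R_3(2) = 3 < 4`) yet
  `≥ m + 1`.  Why EASIER than the crux (what the transfer exposes): the ambient space per factor is the
  FIXED `ℂ^{k!}` and the dictionary the FIXED toric cone `Y_k`, so the statement is about the growth of
  an `X`-rank under tensor powers of one point — the object of the asymptotic-spectrum /
  (non)multiplicativity theory of restricted ranks (Christandl–Jensen–Zuiddam LAA 2018
  doi:10.1016/j.laa.2017.12.020; Christandl–Gesmundo–Jensen SIMAX 2019 doi:10.1137/18m1174829;
  Wigderson–Zuiddam Bull. AMS doi:10.1090/bull/1880), with `6^m` scalar equations per `m` for `k = 3`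
  (small cases `R_3(3), R_3(4)` are certifiable by computer algebra — the route's cheapest falsifier),
  instead of one new secant problem in `ℂ^{n!}` for every `n`.  In the plane sub-model of the route
  (all factors in one plane through `sgn_3`, where `Y_3` cuts out three lines and the problem becomes
  signed-subcube representations of `θ^{|x|}` on `{0,1}^m`) the pigeonhole restriction
  `x_m ∈ {0, 1, 0−1}` already gives `R_plane(m) ≥ (3/2)·R_plane(m−1)`, i.e. `2, 3, 5, 8, …`; the open
  part is precisely that `Y_k` is irreducible and spans, so no finite family of hyperplanes avoiding
  `sgn_k` covers it and the restriction must be replaced by a genuinely toric/secant argument.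
  Why it might fail: shared-parameter interpolation along rational curves in `Y_3` (or border
  degenerations) making `R_3(m)`, and then every `R_k(m)`, polynomial in `m` — the refutation branch of
  `DirectSumExp`, in which X1 needs the global structure of `𝔖_n`.  Size: L–XL (open).

Neither stub is comparable to the crux or to the summit by a cheap implication (BC3 probes
`stub → TdrPerNotQP`, `stub → ValiantsHypothesis` by `first | exact? | simpa | aesop` all FAIL — see the
registrar's NOTES.md): `stub_coneRestriction` is a true structural lemma;
`stub_conePowerRankNotQP → TdrPerNotQP` needs `stub_coneRestriction` plus the quasi-polynomial
transfer along `n = m·k` below, and `TdrPerNotQP → stub_conePowerRankNotQP` is not known (it is the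
direct-sum dichotomy of the route).

COMPOSITION `TdrPerNotQP_of : Stmt.stub_coneRestriction → Stmt.stub_conePowerRankNotQP → TdrPerNotQP`
(kernel-checked, no sorry): given a quasi-polynomial bound `c` for `tdr(per_n)` and the block size `k`
of the second stub, for every `m` restrict the representation of `per_{m·k}` (first stub) to get a cone
product decomposition of `sgn_k^{⊗m}` of length `r ≤ 2^((log₂(mk) + c)^c) ≤ 2^((log₂ m + c')^{c'})`
with `c' = c + k + 1` (`log₂(mk) ≤ log₂ m + k`), contradicting the second stub.

## Shape (skeleton audit by-name rule)
* `Stmt.stub_…` — the two stub statements as precise `Prop`s, named like the stubs;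
* `stub_…` — the same statements as sorried theorems (the REGISTERED stubs; `sorry` occurs nowhere else);
* `TdrPerNotQP_of` — the composition, real proof; `TdrPerNotQP_proof : TdrPerNotQP :=
  TdrPerNotQP_of stub_coneRestriction stub_conePowerRankNotQP` ties the two copies together.
Both stubs are DEF-FREE beyond Mathlib + `Literature.Computability.AlgebraicComplexity.perPoly`, so
each can land as `Theorems/TwistedDetRankTdrPerNotQP<Stub>.lean` with
`--supports stmt-ValiantsHypothesis-6284`.

**Disproof used.** None exists: `Cruxes/TdrPerNotQP/` had no workfiles (no `Disproof.lean`, no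
`Negative/` lemma) at registration (2026-08-17); `ledger negatives --problem ValiantsHypothesis`
(4 entries: UlrichPadded, Elusive, GrenetRigidity ×2) has no statement about twisted determinants,
Birkhoff-cone ranks or direct sums.  Hardest stub: `stub_conePowerRankNotQP`.
-/

namespace Summit.ValiantsHypothesis.ValiantsHypothesis.Cruxes.TdrPerNotQP.Birth

open MvPolynomial Matrix
open Literature.Computability.AlgebraicComplexity
open Summit.ValiantsHypothesis.ValiantsHypothesis.Theses.TwistedDetRank

set_option linter.dupNamespace false

/-! ## The two stub statements -/

/-- STUB 1 — YOUNG-SUBGROUP (BLOCK) RESTRICTION IN COEFFICIENT SPACE (provable now, size M).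
A representation of `per_{m·k}` as a sum of `r` Hadamard-twisted determinants yields a length-`r`
decomposition of `sgn_k^{⊗m}` into products of Birkhoff-cone points: matrices `u t b ∈ ℂ^{k×k}`
(`t < r`, `b < m`; the diagonal blocks of `E_t` after `finProdFinEquiv : Fin m × Fin k ≃ Fin (m*k)`)
with `∑_t ∏_b ∏_i u t b (π_b i) i = ∏_b sgn π_b` for every block permutation `π ∈ 𝔖_k^m`.
[perPoly_eq_sum_twistedDet_iff + Equiv.Perm.sign_prodCongrRight; MarcusMinc1961,
doi:10.1016/j.laa.2017.12.020] -/
def Stmt.stub_coneRestriction : Prop :=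
  ∀ (k m r : ℕ) (E : Fin r → Matrix (Fin (m * k)) (Fin (m * k)) ℂ),
    Literature.Computability.AlgebraicComplexity.perPoly (Fin (m * k)) ℂ =
        ∑ t, (Matrix.of fun i j => MvPolynomial.C (E t i j) * MvPolynomial.X (i, j)).det →
    ∃ u : Fin r → Fin m → Matrix (Fin k) (Fin k) ℂ,
      ∀ π : Fin m → Equiv.Perm (Fin k),
        ∑ t, ∏ b, ∏ i, u t b (π b i) i = ∏ b, ((Equiv.Perm.sign (π b) : ℤ) : ℂ)

/-- STUB 2 — CONE PRODUCT RANK OF A TENSOR POWER IS NOT QUASI-POLYNOMIAL (open; load-bearing).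
For some fixed block size `k`, the least number `R_k(m)` of products `û_1 ⊗ ⋯ ⊗ û_m` of
Birkhoff-cone points (`û(π) = ∏_i u (π i) i`, `u ∈ ℂ^{k×k}`) summing to `sgn_k^{⊗m} ∈ (ℂ^{𝔖_k})^{⊗m}`
is not bounded by `2^((log₂ m + c)^c)` for any `c`.  Implied by the route crux `DirectSumExp`
(`k = 3`, exponential); known `m + 1 ≤ R_3(m) ≤ 2^m`, `R_3(1) = 2`, `R_3(2) = 3`.
[doi:10.1016/j.laa.2017.12.020, doi:10.1137/18m1174829, doi:10.1090/bull/1880, MarcusMinc1961,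
Tesler2000] -/
def Stmt.stub_conePowerRankNotQP : Prop :=
  ∃ k : ℕ, ¬ ∃ c : ℕ, ∀ m : ℕ, ∃ r ≤ 2 ^ ((Nat.log 2 m + c) ^ c),
    ∃ u : Fin r → Fin m → Matrix (Fin k) (Fin k) ℂ,
      ∀ π : Fin m → Equiv.Perm (Fin k),
        ∑ t, ∏ b, ∏ i, u t b (π b i) i = ∏ b, ((Equiv.Perm.sign (π b) : ℤ) : ℂ)

/-! ## Reshape (lead prover, cycle 1): STUB 2 splits into an exponential bound at `k = 3`
and quasi-polynomial bookkeeping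

The load-bearing stub falls to a RANK METHOD that sees the equation of the cone.  The Birkhoff
cone `Y_3 ⊂ ℂ^{𝔖_3}` lies on the cubic `z_{id} z_{(012)} z_{(021)} = z_{(01)} z_{(02)} z_{(12)}`
(product over even permutations = product over odd ones = product of all nine entries of `u`), and
that cubic has a `3 × 3` LINEAR DETERMINANTAL REPRESENTATION
`L(z) = [[z_id, -z_(01), 0], [0, z_(012), z_(02)], [z_(12), 0, z_(021)]]`,
`det L(z) = z_{id} z_{(012)} z_{(021)} - z_{(01)} z_{(02)} z_{(12)}`.
Hence `rank L(û) ≤ 2` for every cone point, while `L(sgn_3) = [[1,1,0],[0,1,-1],[-1,0,1]]` has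
determinant `2`, rank `3`.  Apply the Kronecker power `L^{⊗m}` to a cone product decomposition
`sgn_3^{⊗m} = ∑_{t<r} û_{t,1} ⊗ ⋯ ⊗ û_{t,m}`: the left side becomes the invertible `3^m × 3^m`
matrix `L(sgn_3)^{⊗m}`, each summand a Kronecker product of `m` matrices of rank `≤ 2`, i.e. of rank
`≤ 2^m`; subadditivity of rank gives `3^m ≤ r · 2^m`, i.e. `R_3(m) ≥ (3/2)^m` — EXPONENTIAL
(`stub_conePowerRankThree`).  The remaining bookkeeping `2^((log₂ m + c)^c) · 2^m < 3^m` for some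
`m` (`stub_expBeatsQP`, take `m = 2^L`, `L` large) then gives `Stmt.stub_conePowerRankNotQP` with
`k = 3` (`conePowerRankNotQP_of`, sorry-free below).  The card's "flattenings are blind" concerns
Segre/Laplace flattenings of the product vector `sgn^{⊗m}`; `L` flattens each FACTOR `ℂ^6 → ℂ^{3×3}`
through the cubic equation of `Y_3`, which those do not see. -/

/-- STUB 2a — EXPONENTIAL CONE POWER RANK AT BLOCK SIZE 3 (provable now, size M; the heart).
Every cone product decomposition of `sgn_3^{⊗m}` has length `r` with `3^m ≤ r · 2^m`
(determinantal flattening of the Birkhoff cubic + multiplicativity of Kronecker rank). -/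
def Stmt.stub_conePowerRankThree : Prop :=
  ∀ (m r : ℕ) (u : Fin r → Fin m → Matrix (Fin 3) (Fin 3) ℂ),
    (∀ π : Fin m → Equiv.Perm (Fin 3),
        ∑ t, ∏ b, ∏ i, u t b (π b i) i = ∏ b, ((Equiv.Perm.sign (π b) : ℤ) : ℂ)) →
      3 ^ m ≤ r * 2 ^ m

/-- STUB 2b — EXPONENTIAL BEATS QUASI-POLYNOMIAL (provable now, size S; pure arithmetic).
For every `c` some `m` has `2^((log₂ m + c)^c) · 2^m < 3^m` (e.g. `m = 2^L`: `log₂ m = L` and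
`(L + c)^c < (log₂ 3 - 1) · 2^L` for large `L`; or `3^8 > 2^12`). -/
def Stmt.stub_expBeatsQP : Prop :=
  ∀ c : ℕ, ∃ m : ℕ, 2 ^ ((Nat.log 2 m + c) ^ c) * 2 ^ m < 3 ^ m

/-! ## Registered stubs — ALL CLOSED (each landed under `Theorems/TwistedDetRankTdrPerNotQPStub*.lean`
with `--supports stmt-ValiantsHypothesis-6284`; no `sorry` is left in this file) -/

/-- Registered stub 1 = `Stmt.stub_coneRestriction` (Young-subgroup restriction of a twisted
representation of `per_{m·k}` to a cone product decomposition of `sgn_k^{⊗m}`). -/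
theorem stub_coneRestriction :
    ∀ (k m r : ℕ) (E : Fin r → Matrix (Fin (m * k)) (Fin (m * k)) ℂ),
      Literature.Computability.AlgebraicComplexity.perPoly (Fin (m * k)) ℂ =
          ∑ t, (Matrix.of fun i j => MvPolynomial.C (E t i j) * MvPolynomial.X (i, j)).det →
      ∃ u : Fin r → Fin m → Matrix (Fin k) (Fin k) ℂ,
        ∀ π : Fin m → Equiv.Perm (Fin k),
          ∑ t, ∏ b, ∏ i, u t b (π b i) i = ∏ b, ((Equiv.Perm.sign (π b) : ℤ) : ℂ) :=
  Summit.ValiantsHypothesis.ValiantsHypothesis.Theorems.TwistedDetRankTdrPerNotQP.stub_coneRestriction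

/-- Registered stub 2a = `Stmt.stub_conePowerRankThree` (`R_3(m) ≥ (3/2)^m`: a cone product
decomposition of `sgn_3^{⊗m}` of length `r` has `3^m ≤ r · 2^m`). -/
theorem stub_conePowerRankThree :
    ∀ (m r : ℕ) (u : Fin r → Fin m → Matrix (Fin 3) (Fin 3) ℂ),
      (∀ π : Fin m → Equiv.Perm (Fin 3),
          ∑ t, ∏ b, ∏ i, u t b (π b i) i = ∏ b, ((Equiv.Perm.sign (π b) : ℤ) : ℂ)) →
        3 ^ m ≤ r * 2 ^ m :=
  Summit.ValiantsHypothesis.ValiantsHypothesis.Theorems.TwistedDetRankTdrPerNotQP.stub_conePowerRankThree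

/-- Registered stub 2b = `Stmt.stub_expBeatsQP` (for every `c` some `m` has
`2^((log₂ m + c)^c) · 2^m < 3^m`). -/
theorem stub_expBeatsQP :
    ∀ c : ℕ, ∃ m : ℕ, 2 ^ ((Nat.log 2 m + c) ^ c) * 2 ^ m < 3 ^ m :=
  Summit.ValiantsHypothesis.ValiantsHypothesis.Theorems.TwistedDetRankTdrPerNotQP.stub_expBeatsQP

/-! ## The composition (kernel-checked, sorry-free) -/

/-- Stub 2 from stubs 2a + 2b: with `k = 3`, a quasi-polynomial bound `r ≤ 2^((log₂ m + c)^c)` on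
the length of a cone product decomposition of `sgn_3^{⊗m}` contradicts `3^m ≤ r · 2^m` at the `m`
supplied by `stub_expBeatsQP`. -/
theorem conePowerRankNotQP_of :
    Stmt.stub_conePowerRankThree → Stmt.stub_expBeatsQP → Stmt.stub_conePowerRankNotQP := by
  intro h3 hexp
  unfold Stmt.stub_conePowerRankThree at h3
  unfold Stmt.stub_expBeatsQP at hexp
  unfold Stmt.stub_conePowerRankNotQP
  refine ⟨3, ?_⟩
  rintro ⟨c, hc⟩
  obtain ⟨m, hm⟩ := hexp c
  obtain ⟨r, hr, u, hu⟩ := hc m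
  have h1 : 3 ^ m ≤ r * 2 ^ m := h3 m r u hu
  have h2 : r * 2 ^ m ≤ 2 ^ ((Nat.log 2 m + c) ^ c) * 2 ^ m := Nat.mul_le_mul_right _ hr
  omega

/-- `log₂ (m·k) ≤ log₂ m + k` (crude, all naturals). -/
theorem log_two_mul_le (m k : ℕ) : Nat.log 2 (m * k) ≤ Nat.log 2 m + k := by
  rcases Nat.eq_zero_or_pos (m * k) with h0 | h0
  · simp [h0]
  · have hlt : m * k < 2 ^ (Nat.log 2 m + 1 + k) := by
      calc m * k < 2 ^ (Nat.log 2 m + 1) * 2 ^ k :=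
            Nat.mul_lt_mul'' (Nat.lt_pow_succ_log_self one_lt_two m) Nat.lt_two_pow_self
        _ = 2 ^ (Nat.log 2 m + 1 + k) := by rw [← pow_add]
    have := (Nat.log_lt_iff_lt_pow one_lt_two h0.ne').2 hlt
    omega

/-- Quasi-polynomial bookkeeping along `n = m·k`: a bound `2^((log₂(mk) + c)^c)` is a bound
`2^((log₂ m + c')^{c'})` with `c' = c + k + 1`. -/
theorem qp_transfer (m k c : ℕ) :
    2 ^ ((Nat.log 2 (m * k) + c) ^ c) ≤ 2 ^ ((Nat.log 2 m + (c + k + 1)) ^ (c + k + 1)) := by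
  have hlog := log_two_mul_le m k
  calc 2 ^ ((Nat.log 2 (m * k) + c) ^ c)
      ≤ 2 ^ ((Nat.log 2 m + (c + k + 1)) ^ c) :=
        Nat.pow_le_pow_right two_pos (Nat.pow_le_pow_left (by omega) c)
    _ ≤ 2 ^ ((Nat.log 2 m + (c + k + 1)) ^ (c + k + 1)) :=
        Nat.pow_le_pow_right two_pos (Nat.pow_le_pow_right (by omega) (by omega))

/-- **The crux from stub 1 and (the statement of) stub 2.**  Given a quasi-polynomial bound `c` on
`tdr(per_n)` and the block size `k` of the second statement: for every `m`, the first stub restricts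
the short representation of `per_{m·k}` to a cone product decomposition of `sgn_k^{⊗m}` of the same
length `r ≤ 2^((log₂(mk) + c)^c) ≤ 2^((log₂ m + c')^{c'})`, `c' = c + k + 1` — a quasi-polynomial
bound on `R_k`, which the second statement forbids. -/
theorem TdrPerNotQP_of_notQP :
    Stmt.stub_coneRestriction → Stmt.stub_conePowerRankNotQP →
      Summit.ValiantsHypothesis.ValiantsHypothesis.Theses.TwistedDetRank.TdrPerNotQP := by
  intro h1 h2
  unfold Stmt.stub_coneRestriction at h1
  unfold Stmt.stub_conePowerRankNotQP at h2
  unfold Summit.ValiantsHypothesis.ValiantsHypothesis.Theses.TwistedDetRank.TdrPerNotQP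
  rintro ⟨c, hc⟩
  obtain ⟨k, hk⟩ := h2
  apply hk
  refine ⟨c + k + 1, fun m => ?_⟩
  obtain ⟨r, hr, E, hE⟩ := hc (m * k)
  obtain ⟨u, hu⟩ := h1 k m r E hE
  exact ⟨r, hr.trans (qp_transfer m k c), u, hu⟩

/-- **The crux from the three registered stubs** (restriction, exponential cone power rank at
`k = 3`, exponential-beats-quasi-polynomial bookkeeping). -/
theorem TdrPerNotQP_of :
    Stmt.stub_coneRestriction → Stmt.stub_conePowerRankThree → Stmt.stub_expBeatsQP →
      Summit.ValiantsHypothesis.ValiantsHypothesis.Theses.TwistedDetRank.TdrPerNotQP :=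
  fun h1 h3 hexp => TdrPerNotQP_of_notQP h1 (conePowerRankNotQP_of h3 hexp)

/-- THE SKELETON: the crux, modulo exactly the three registered stubs (compiler-checks that the
`Stmt` copies and the stub statements agree). -/
theorem TdrPerNotQP_proof :
    Summit.ValiantsHypothesis.ValiantsHypothesis.Theses.TwistedDetRank.TdrPerNotQP :=
  TdrPerNotQP_of stub_coneRestriction stub_conePowerRankThree stub_expBeatsQP

end Summit.ValiantsHypothesis.ValiantsHypothesis.Cruxes.TdrPerNotQP.Birth
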